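import Mathlib
import HarnessLib
import Summits.FinalStateConjecture.FinalStateConjecture.Theorems.BartnikGapSettlingBondiBartnikRigidityTrivialRegime
import Summits.FinalStateConjecture.FinalStateConjecture.Theorems.BartnikGapSettlingBondiBartnikRigidityDirectMethodLeafDefs
import Summits.FinalStateConjecture.FinalStateConjecture.Theorems.BartnikGapSettlingBondiBartnikRigidityStationaryKerrCollarRouteOriented
import Literature.Geometry.Lorentzian.BondiBartnikGap
import Literature.Geometry.Lorentzian.NearKerrCollarCore
import Literature.Geometry.Lorentzian.SoundNearKerrLeaf

/-!
# Route BartnikGapSettling — crux `BondiBartnikRigidity` (stmt-FinalStateConjecture-10807):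
# the SECTOR DECOMPOSITION of the filed item (crux-strategist s2, 2026-08-17)

The filed crux (rev 2 of `Theses/BartnikGapSettling.lean`: `∀ Λ < ⊤`, any number `N` of collars, any
probe point `p ∈ S`, TYPED hypothesis and conclusion leaves, competitor-gap hypothesis) is split
along the sector boundary that five line leads, two triage panels and the disprover's anchors
(`DeviationTolerance.lean`, `NearKerrLeafMinkowskiDodge*.lean`, `NearKerrLeafMinkowskiFakeHoles.lean`)
have established, into THREE typed pieces and a PROVED glue (a two-layer split, D-0019; k = 3):

* `CollarSectorOwnEnergyRigidity` — the honest `N = 1` engine in OWN-ENERGY currency: below the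
  honesty threshold `Λ < 1`, a PINNED SOUND `(Λ, k')`-leaf through a REST-FRAME, FUTURE-ORIENTED
  `δ`-near-Kerr thick collar containing the probe point, whose collar core has a cut Bondi energy
  `≤ M + γ`, is followed inside `J⁺(core)` by a SOUND `(ε, k)`-near-Kerr leaf (not dodge- or
  fake-hole-satisfiable).  No competitor quantifier.
* `ConeEnergyPinchesFlatSound` — the honest `N = 0` engine (verbatim the probe worker's merged fact
  F_far′ of lead a2's wave 1): small cone cut energy at a point of an honest `(Λ, k')`-leaf pinches a
  SOUND `(ε, k)`-flat leaf inside `J⁺({p})`.  Own-energy currency.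
* `GapCurrencyDebt` — everything the FILED gap-currency text asks beyond the two engines, in one
  support piece that the pending own-currency restatement of the parent makes moot: (a) cheap point
  competitors (verbatim B1 `ProbeBartnikMassZero` of line `hyperboloidal-mass-pinches-flat`: a point of
  `J⁺(ι X)` has admissible competitors of arbitrarily small cut energy); (b) cheap collar competitors
  (a `δ`-near-Kerr thick collar core of label `(M, a)` has admissible competitors of cut energy
  `≤ M + η`: the Kerr-capped competitor by exterior gluing, keeping the development's own interior) —
  (a), (b) honest but Lean-inert today (no constructible admissible competitor besides the identity);
  (c) the FILED-TEXT RESIDUE, verbatim the flagged residue stub of the registered skeleton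
  `Cruxes/BondiBartnikRigidity/Lines/direct_method_on_the_cone.lean` rev 6 (sectors `1 ≤ Λ`, `2 ≤ N`,
  `N = 1 ∧ p ∉ collar`, `N = 1 ∧ ¬(pinned-sound ∧ rest-frame ∧ oriented)`: junk-true on paper by dodging
  leaves and fake holes, Lean-undecidable, never to be staffed).

`BondiBartnikRigidity_of_subs : CollarSectorOwnEnergyRigidity → ConeEnergyPinchesFlatSound →
GapCurrencyDebt → <body of BondiBartnikRigidity, verbatim>` is pure logic (sorry-free): `k'` = max of
the pieces' orders, `δ`/`γ` minima with the own-energy budgets halved to absorb the competitor slack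
`η`; trivial regime `Λ ≤ ε` by the landed `Theorems.stub_trivialRegime` (p103152); `ε < Λ < 1` by cases
`N = 0` (gap + (a) ⇒ own cone energy `≤ γ₂`, then the `N = 0` engine; sound ⇒ typed, `J⁺{p} ⊆ J⁺(S)`),
`N = 1` honest sub-sector (gap + (b) ⇒ own collar energy `≤ M + γ₁`, then the `N = 1` engine; sound ⇒
typed, `J⁺(core) ⊆ J⁺(S)`), everything else and `1 ≤ Λ` the residue (c).  This file is the
kernel-checked glue of the strategist's `route edit --split` (crux-strategist s2, 2026-08-17); a prover
lands it verbatim and closes the route's glue item by `fun h₁ h₂ h₃ => BondiBartnikRigidity_of_subs h₁ h₂ h₃`.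

References: HuangLee2020 Def. 7.8 (Bartnik's infimum); DHRT arXiv:2104.08222 §1 (chart vocabulary);
Bartnik2002ICM Def. 4; CorvinoSchoen2006 / ChruscielDelay2003 (exterior Kerr gluing);
ChristodoulouKlainerman1993PMS41 Ch. 17 (cut Bondi energies).
-/

noncomputable section

-- D-0017: single-problem summit, `Summit.<S>.<S>.…` by design (cf. lakefile `weak.linter.dupNamespace`).
set_option linter.dupNamespace false

open Set Filter Function Topology TopologicalSpace
open Literature.Geometry.Lorentzian
open Summit.FinalStateConjecture.FinalStateConjecture.Theorems.BondiBartnikRigidity.DirectMethod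
open scoped Manifold ContDiff Topology ENNReal BigOperators

namespace Summit.FinalStateConjecture.FinalStateConjecture.Theorems.BondiBartnikRigidity.Split

/-! ## The three pieces (and the components of the third) -/

/-- **Piece 1 — the `N = 1` engine in own-energy currency** (`CollarSectorOwnEnergyRigidity`).  For
every margin `χ < 1`, window `m₀`, target `(k, ε)` there is an input order `k'` such that for every
HONEST geometry bound `Λ < 1` above the trivial regime (`ε < Λ`) there are `δ, γ > 0` with: whenever a
maximal vacuum Cauchy development `𝒟` of an admissible datum contains a PINNED SOUND `(Λ, k')`-near-Kerr
leaf `S` with one hole of label `(M, a)` in the window, `|a| ≤ χ M`, a probe point `p ∈ S`, and ONE thick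
collar chart `Φ` of the REST-FRAME boosted Kerr-star background (`(mo 0).1 = 1`), smooth open embedding
of the collar layer, `δ`-close in `C^{k'}` to Kerr`(M, a)` on the thick slab `{t* = 0, M < r ≤ 3M}`, slab
inside `S` and containing `p`, FUTURE- and TIME-ORIENTED (`K2Route.CollarFutureOriented`,
`K2Route.CollarTimeOriented`), whose collar core has a cut Bondi energy `m ≤ M + γ` — then a SOUND
`(ε, k)`-near-Kerr leaf with the same label lies in `J⁺(core)`.  The honest `N = 1` content of the filed
crux with the hypothesis-side repairs of leads a2/c3 (pinned-sound leaf, rest-frame oriented collar),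
the conclusion-side repair of DODGE-c2 (sound leaf) and the currency repair R3 of the `GapExhaustion`
audits (own energy, no competitor quantifier).  Its exact case is Kerr-collar minimality with rigidity
(a null Penrose-type inequality with angular momentum from the photon shell); open. [conjecture]
[cite: HuangLee2020, Def. 7.8] -/
def CollarSectorOwnEnergyRigidity : Prop :=
  ∀ (χ m₀ : ℝ) (k : ℕ) (ε : ℝ≥0∞), χ < 1 → 0 < m₀ → 0 < ε → ∃ k' : ℕ, ∀ Λ : ℝ≥0∞, Λ < 1 → ε < Λ →
    ∃ (δ : ℝ≥0∞) (γ : ℝ), 0 < δ ∧ 0 < γ ∧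
    ∀ (X : Type) [TopologicalSpace X] [ChartedSpace E3 X] [IsManifold (𝓡 3) ∞ X]
      [T2Space X] [SecondCountableTopology X] [ConnectedSpace X],
    ∀ D ∈ admissibleVacuumData X, ∀ (𝒟 : VacuumCauchyDevelopment D)
      (M a : Fin 1 → ℝ) (S : Set 𝒟.carrier) (p : 𝒟.carrier) (mo : Fin 1 → lorentzGroup × E4)
      (B : Fin 1 → ModelBackground) (Φ : ∀ i, (B i).domain → 𝒟.carrier),
    𝒟.IsMaximal → (∀ i, m₀ ≤ M i ∧ M i ≤ m₀⁻¹ ∧ |a i| ≤ χ * M i) →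
    IsPinnedSoundNearKerrLeaf 𝒟.toCauchyDevelopment k' Λ 1 M a S → p ∈ S →
    (∃ i, p ∈ Φ i '' (B i).truncTimeSlab (3 * M i) 0) → (mo 0).1 = 1 →
    (∀ i, B i = starBackground (mo i).1 (mo i).2 (M i) (a i)
      (fun x => Kerr.radius (a i) (poincareInv (mo i).1 (mo i).2 x))) →
    (∀ i, ContMDiffOn 𝓘(ℝ, E4) (𝓡 4) ∞ (Φ i)
        {x | -1 < (B i).time x.1 ∧ (B i).time x.1 < 1 ∧ (B i).radius x.1 < 3 * M i + 1} ∧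
      IsOpenEmbedding ({x | -1 < (B i).time x.1 ∧ (B i).time x.1 < 1 ∧
        (B i).radius x.1 < 3 * M i + 1}.restrict (Φ i))) →
    (∀ i, 𝒟.toSpacetime.truncDeviationCk (B i) (Φ i) k' (3 * M i) 0 ≤ δ) →
    (∀ i, Φ i '' (B i).truncTimeSlab (3 * M i) 0 ⊆ S) →
    K2Route.CollarFutureOriented 𝒟 M mo B Φ → K2Route.CollarTimeOriented 𝒟 M a mo B Φ →
    (∃ m : ℝ, 𝒟.toCauchyDevelopment.HasCutBondiMass (collarCore M p B Φ) m ∧ m ≤ M 0 + γ) →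
    ∃ S' : Set 𝒟.carrier, 𝒟.toCauchyDevelopment.IsSoundNearKerrLeaf k ε 1 M a S' ∧
      S' ⊆ 𝒟.metric.causalFuture 𝒟.timeOrientation (collarCore M p B Φ)

/-- **Piece 2 — the `N = 0` engine, sound form** (`ConeEnergyPinchesFlatSound`; verbatim the merged
fact F_far′ of the probe worker of lead a2, `Lines/direct_method_on_the_cone_Probe.lean`).  For every
target `(k, ε)` there is `k'` such that below the honesty threshold some `γ > 0` makes: a TYPED
`(Λ, k')`-leaf `S ∋ p` without holes in an MGHD of admissible data whose cone cut at `p` has an energy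
`≤ γ` is followed INSIDE `J⁺({p})` by a SOUND `(ε, k)`-flat leaf.  A large-data semi-global
stability-of-Minkowski statement near `𝓘⁺` inside `J⁺(p)` driven by smallness of the Bondi energy of
the cut of `C⁺(p)`; in print only the small-data / exterior / `ε = 0` endpoints (CK 1993 Thm. 1.0.2,
Klainerman–Nicolò 2003, Chruściel–Paetz arXiv:1401.3789 p. 4).  MISSING; open as stated. [conjecture]
[cite: ChristodoulouKlainerman1993PMS41, Thm. 1.0.2 and Ch. 17, Conclusion 17.0.4] -/
def ConeEnergyPinchesFlatSound : Prop :=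
  ∀ (k : ℕ) (ε : ℝ≥0∞), 0 < ε → ∃ k' : ℕ, ∀ Λ : ℝ≥0∞, Λ < 1 → ∃ γ : ℝ, 0 < γ ∧
    ∀ (X : Type) [TopologicalSpace X] [ChartedSpace E3 X] [IsManifold (𝓡 3) ∞ X]
      [T2Space X] [SecondCountableTopology X] [ConnectedSpace X],
    ∀ D ∈ admissibleVacuumData X, ∀ (𝒟 : VacuumCauchyDevelopment D) (M a : Fin 0 → ℝ)
      (S : Set 𝒟.carrier) (p : 𝒟.carrier) (m : ℝ),
    𝒟.IsMaximal → 𝒟.toCauchyDevelopment.IsNearKerrLeaf k' Λ 0 M a S → p ∈ S →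
    𝒟.toCauchyDevelopment.HasCutBondiMass ({p} : Set 𝒟.carrier) m → m ≤ γ →
    ∃ S' : Set 𝒟.carrier, 𝒟.toCauchyDevelopment.IsSoundNearKerrLeaf k ε 0 M a S' ∧
      S' ⊆ 𝒟.metric.causalFuture 𝒟.timeOrientation ({p} : Set 𝒟.carrier)

/-- **Component (a) of piece 3 — cheap POINT competitors** (verbatim B1 `ProbeBartnikMassZero` of line
`hyperboloidal-mass-pinches-flat`): on an MGHD of admissible vacuum data a point `p ∈ J⁺(ι X)` has
admissible competitors (`IsCompetitorMass`) of arbitrarily small cut energy — Bartnik's mass of a point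
is zero (small-data extension of a neighbourhood of `p`, Czimek 2017 / Carlotto–Schoen, and
`M(u) ≤ M_ADM`, CK 1993 Ch. 17).  Not in print as stated; Lean-inert today (no constructible admissible
competitor: `MGHDExists`/CBG and the round-section machinery are missing). [conjecture]
[cite: Bartnik2002ICM, Def. 4] -/
def CheapPointCompetitors : Prop :=
  ∀ (X : Type) [TopologicalSpace X] [ChartedSpace E3 X] [IsManifold (𝓡 3) ∞ X]
      [T2Space X] [SecondCountableTopology X] [ConnectedSpace X],
    ∀ D ∈ admissibleVacuumData X, ∀ (𝒟 : VacuumCauchyDevelopment D) (p : 𝒟.carrier),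
    𝒟.IsMaximal → p ∈ 𝒟.metric.causalFuture 𝒟.timeOrientation (range 𝒟.embed) →
    ∀ η : ℝ, 0 < η → ∃ m' : ℝ, 𝒟.IsCompetitorMass ({p} : Set 𝒟.carrier) m' ∧ m' ≤ η

/-- **Component (b) of piece 3 — cheap COLLAR competitors** (the Kerr-capped competitor).  For every
margin and window there is an order `k₀` such that for every `η > 0` some `δ > 0` makes: every thick
collar chart of the boosted Kerr-star background of label `(M, a)` in the window, smooth open embedding
of the collar layer, `δ`-close in `C^{k₀}` to Kerr on the thick slab, with the probe point on the slab,
in an MGHD of admissible data, has an admissible competitor for its collar core of cut energy `≤ M + η`.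
On paper: extend a slightly larger slab to a Cauchy surface (Bernal–Sánchez), keep the development's
own interior data and glue the exterior across `{3M + ½ < r < 3M + 1}` to exact Kerr`(M', a')`,
`|M' − M| ≲ δ` (Corvino–Schoen / Chruściel–Delay perturbative gluing with Kerr-family compensation of
the KID cokernel); the cut energy is `≤ M_ADM = M'` by mass loss.  Not in print as stated (finite
retarded-time exterior control with cut energies); Lean-inert today. [conjecture]
[cite: Bartnik2002ICM, Def. 4] -/
def CheapCollarCompetitors : Prop :=
  ∀ (χ m₀ : ℝ), χ < 1 → 0 < m₀ → ∃ k₀ : ℕ, ∀ η : ℝ, 0 < η → ∃ δ : ℝ≥0∞, 0 < δ ∧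
    ∀ (X : Type) [TopologicalSpace X] [ChartedSpace E3 X] [IsManifold (𝓡 3) ∞ X]
      [T2Space X] [SecondCountableTopology X] [ConnectedSpace X],
    ∀ D ∈ admissibleVacuumData X, ∀ (𝒟 : VacuumCauchyDevelopment D)
      (M a : Fin 1 → ℝ) (p : 𝒟.carrier) (mo : Fin 1 → lorentzGroup × E4)
      (B : Fin 1 → ModelBackground) (Φ : ∀ i, (B i).domain → 𝒟.carrier),
    𝒟.IsMaximal → (∀ i, m₀ ≤ M i ∧ M i ≤ m₀⁻¹ ∧ |a i| ≤ χ * M i) →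
    (∃ i, p ∈ Φ i '' (B i).truncTimeSlab (3 * M i) 0) →
    (∀ i, B i = starBackground (mo i).1 (mo i).2 (M i) (a i)
      (fun x => Kerr.radius (a i) (poincareInv (mo i).1 (mo i).2 x))) →
    (∀ i, ContMDiffOn 𝓘(ℝ, E4) (𝓡 4) ∞ (Φ i)
        {x | -1 < (B i).time x.1 ∧ (B i).time x.1 < 1 ∧ (B i).radius x.1 < 3 * M i + 1} ∧
      IsOpenEmbedding ({x | -1 < (B i).time x.1 ∧ (B i).time x.1 < 1 ∧
        (B i).radius x.1 < 3 * M i + 1}.restrict (Φ i))) →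
    (∀ i, 𝒟.toSpacetime.truncDeviationCk (B i) (Φ i) k₀ (3 * M i) 0 ≤ δ) →
    ∃ m' : ℝ, 𝒟.IsCompetitorMass (collarCore M p B Φ) m' ∧ m' ≤ M 0 + η

/-- **Component (c) of piece 3 — the FILED-TEXT RESIDUE, never to be staffed** (`FiledTextResidue`; verbatim the flagged
stub `stub_filedTextResidue` of the registered skeleton rev 6).  The sectors of the crux AS FILED outside
the honest regime: `1 ≤ Λ` (collapsed flat charts certify nothing, `Spacetime.deviationCk_hypBackground_top_le`);
`2 ≤ N` (seamed cores carry no cut energy); `N = 1` with `p` off the collar; `N = 1` with a hypothesis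
leaf that is not pinned sound at the working order or a collar chart that is not rest-frame or not
future- or time-oriented.  Junk-TRUE on paper in all four sectors (dodging conclusion leaves,
`Minkowski.exists_isNearKerrLeaf_subset_causalFuture_forall_dist_lt`, and fake holes), FALSE given the
unsupported `H` of the landed Negative lemma `BondiBartnikRigidity_false_of_blindCollapsedLeafExists`,
Lean-undecidable either way (DODGE-c2 §3); isolated as a piece only so that the glue below is total, and
deleted by the restatement of the parent.  [conjecture] [folklore] -/
def FiledTextResidue : Prop :=
  ∀ (χ m₀ : ℝ) (N₀ k : ℕ) (ε : ℝ≥0∞), χ < 1 → 0 < m₀ → 0 < ε →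
    ∃ k₀ : ℕ, ∀ k' : ℕ, k₀ ≤ k' → ∀ Λ : ℝ≥0∞, Λ < ⊤ → ε < Λ → ∃ (δ : ℝ≥0∞) (γ : ℝ), 0 < δ ∧ 0 < γ ∧
    ∀ (X : Type) [TopologicalSpace X] [ChartedSpace E3 X] [IsManifold (𝓡 3) ∞ X]
      [T2Space X] [SecondCountableTopology X] [ConnectedSpace X],
    ∀ D ∈ admissibleVacuumData X, ∀ (𝒟 : VacuumCauchyDevelopment D) (N : ℕ)
      (M a : Fin N → ℝ) (S : Set 𝒟.carrier) (p : 𝒟.carrier) (mo' : Fin N → lorentzGroup × E4)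
      (B' : Fin N → ModelBackground) (Φ : ∀ i, (B' i).domain → 𝒟.carrier),
    (1 ≤ Λ ∨ 2 ≤ N ∨ (N = 1 ∧ ∀ i, p ∉ Φ i '' (B' i).truncTimeSlab (3 * M i) 0) ∨
      (N = 1 ∧ ¬ (IsPinnedSoundNearKerrLeaf 𝒟.toCauchyDevelopment k' Λ N M a S ∧
        (∀ i, (mo' i).1 = 1) ∧ K2Route.CollarFutureOriented 𝒟 M mo' B' Φ ∧
        K2Route.CollarTimeOriented 𝒟 M a mo' B' Φ))) →
    𝒟.IsMaximal → N ≤ N₀ → (∀ i, m₀ ≤ M i ∧ M i ≤ m₀⁻¹ ∧ |a i| ≤ χ * M i) →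
    𝒟.toCauchyDevelopment.IsNearKerrLeaf k' Λ N M a S → p ∈ S →
    (∀ i, B' i = starBackground (mo' i).1 (mo' i).2 (M i) (a i)
      (fun x => Kerr.radius (a i) (poincareInv (mo' i).1 (mo' i).2 x))) →
    (∀ i, ContMDiffOn 𝓘(ℝ, E4) (𝓡 4) ∞ (Φ i)
        {x | -1 < (B' i).time x.1 ∧ (B' i).time x.1 < 1 ∧ (B' i).radius x.1 < 3 * M i + 1} ∧
      Topology.IsOpenEmbedding ({x | -1 < (B' i).time x.1 ∧ (B' i).time x.1 < 1 ∧
        (B' i).radius x.1 < 3 * M i + 1}.restrict (Φ i))) →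
    (∀ i, 𝒟.toSpacetime.truncDeviationCk (B' i) (Φ i) k' (3 * M i) 0 ≤ δ) →
    (∀ i, Φ i '' (B' i).truncTimeSlab (3 * M i) 0 ⊆ S) →
    Pairwise (Function.onFun Disjoint fun i => Φ i '' (B' i).truncTimeSlab (3 * M i) 0) →
    (∃ m : ℝ, 𝒟.toCauchyDevelopment.HasCutBondiMass
      ({p} ∪ ⋃ i, Φ i '' (B' i).truncTimeSlab (3 * M i) 0) m) →
    𝒟.BondiBartnikGapLE ({p} ∪ ⋃ i, Φ i '' (B' i).truncTimeSlab (3 * M i) 0) γ →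
    ∃ S' : Set 𝒟.carrier, 𝒟.toCauchyDevelopment.IsNearKerrLeaf k ε N M a S' ∧
      S' ⊆ 𝒟.metric.causalFuture 𝒟.timeOrientation S

/-- **Piece 3 — `GapCurrencyDebt`**: everything the FILED gap-currency text asks beyond the two
own-energy engines — (a) cheap point competitors, (b) cheap collar competitors (both honest, Lean-inert),
(c) the junk filed-text residue — bundled in ONE support piece because the pending OWN-ENERGY
restatement of the parent (R3 of the `GapExhaustion` audits; `RESTATED_s1.lean` / this seat's census §5)
deletes (c) and no longer needs (a)/(b).  Never to be staffed before that restatement; its only role is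
to make the glue below total over the filed text. [conjecture] [folklore] -/
def GapCurrencyDebt : Prop :=
  CheapPointCompetitors ∧ CheapCollarCompetitors ∧ FiledTextResidue

/-! ## The glue -/

section Glue

variable {X : Type} [TopologicalSpace X] [ChartedSpace E3 X] [IsManifold (𝓡 3) ∞ X]
  [ConnectedSpace X] {D : InitialDataSet (𝓡 3) X}

/-- Gap + cheap competitors ⇒ small own cut energy (the currency conversion, pointwise): if the core `C`
has a competitor mass `≤ b` and its Bondi–Bartnik gap is `≤ γ`, then for every `η > 0` its own cut has
an energy `≤ b + γ + η`. [folklore] -/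
theorem exists_hasCutBondiMass_le_of_gap (𝒟 : VacuumCauchyDevelopment D) {C : Set 𝒟.carrier}
    {γ b : ℝ} (hcheap : ∃ m' : ℝ, 𝒟.IsCompetitorMass C m' ∧ m' ≤ b)
    (hgap : 𝒟.BondiBartnikGapLE C γ) {η : ℝ} (hη : 0 < η) :
    ∃ m : ℝ, 𝒟.toCauchyDevelopment.HasCutBondiMass C m ∧ m ≤ b + γ + η := by
  obtain ⟨m', hm', hm'le⟩ := hcheap
  obtain ⟨m, hm, hmle⟩ :=
    (VacuumCauchyDevelopment.bondiBartnikGapLE_iff.1 hgap) m' hm' η hη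
  exact ⟨m, hm, by linarith⟩

end Glue

/-- **The sector decomposition closes the filed crux** (pure logic, sorry-free): the type is the body
of `Theses.BartnikGapSettling.BondiBartnikRigidity` VERBATIM.  `k'` is the maximum of the pieces'
orders (and `k`); at a given `Λ`: `Λ ≤ ε` — the landed trivial regime; `1 ≤ Λ` — residue; `ε < Λ < 1` —
`δ`/`γ` are minima of the pieces' tolerances with the own-energy budgets HALVED (`γ ≤ γᵢ/2`, competitor
slack `η = γᵢ/4`), then by cases on `N`: `N = 0`: component (a) + gap ⇒ own cone energy `≤ γ₂` ⇒ piece 2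
(sound ⇒ typed, `J⁺{p} ⊆ J⁺(S)`); `N = 1`, `p` in the collar, pinned-sound leaf at order `k'`,
rest-frame oriented collar: component (b) + gap ⇒ own collar energy `≤ M + γ₁` ⇒ piece 1 (sound ⇒ typed,
`J⁺(core) ⊆ J⁺(S)`); otherwise residue; `N ≥ 2` residue. [folklore] -/
theorem BondiBartnikRigidity_of_subs (h₁ : CollarSectorOwnEnergyRigidity)
    (h₂ : ConeEnergyPinchesFlatSound) (h₃ : GapCurrencyDebt) :
    open Literature.Geometry.Lorentzian in ∀ (χ m₀ : ℝ) (N₀ k : ℕ) (ε : ENNReal), χ < 1 → 0 < m₀ → 0 < ε → ∃ k' : ℕ, ∀ Λ : ENNReal, Λ < ⊤ → ∃ (δ : ENNReal) (γ : ℝ), 0 < δ ∧ 0 < γ ∧ ∀ (X : Type) [TopologicalSpace X] [ChartedSpace E3 X] [IsManifold (𝓡 3) ((⊤ : ℕ∞) : WithTop ℕ∞) X] [T2Space X] [SecondCountableTopology X] [ConnectedSpace X], ∀ D ∈ admissibleVacuumData X, ∀ (𝒟 : VacuumCauchyDevelopment D) (N : ℕ) (M a : Fin N → ℝ) (S : Set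 𝒟.carrier) (p : 𝒟.carrier) (mo' : Fin N → lorentzGroup × E4) (B' : Fin N → ModelBackground) (Φ : ∀ i, (B' i).domain → 𝒟.carrier), 𝒟.IsMaximal → N ≤ N₀ → (∀ i, m₀ ≤ M i ∧ M i ≤ m₀⁻¹ ∧ |a i| ≤ χ * M i) → 𝒟.toCauchyDevelopment.IsNearKerrLeaf k' Λ N M a S → p ∈ S → (∀ i, B' i = starBackground (mo' i).1 (mo' i).2 (M i) (a i) (fun x => Kerr.radius (a i) (poincareInv (mo' i).1 (mo' i).2 x))) → (∀ i, ContMDiffOn 𝓘(ℝ, E4) (𝓡 4) ((⊤ : ℕ∞) : WithTop ℕ∞) (Φ i) {x | -1 < (B' i).time x.1 ∧ (B' i).time x.1 < 1 ∧ (B' i).radius x.1 < 3 * M i + 1} ∧ Topology.IsOpenEmbedding ({x | -1 < (B' i).time x.1 ∧ (B' i).time x.1 < 1 ∧ (B' i).radius x.1 < 3 * M i + 1}.restrict (Φ i))) → (∀ i, 𝒟.toSpacetime.truncDeviationCk (B' i) (Φ i) k' (3 * M i) 0 ≤ δ) → (∀ i, Φ i '' (B' i).truncTimeSlab (3 * M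 i) 0 ⊆ S) → Pairwise (Function.onFun Disjoint fun i => Φ i '' (B' i).truncTimeSlab (3 * M i) 0) → (∃ m : ℝ, 𝒟.toCauchyDevelopment.HasCutBondiMass ({p} ∪ ⋃ i, Φ i '' (B' i).truncTimeSlab (3 * M i) 0) m) → (∀ (X' : Type) [TopologicalSpace X'] [ChartedSpace E3 X'] [IsManifold (𝓡 3) ((⊤ : ℕ∞) : WithTop ℕ∞) X'] [T2Space X'] [SecondCountableTopology X'] [ConnectedSpace X'], ∀ D' ∈ admissibleVacuumData X', ∀ (𝒟' : VacuumCauchyDevelopment D') (U : Set 𝒟.carrier) (φ : 𝒟.carrier → 𝒟'.carrier) (m' : ℝ), 𝒟'.IsMaximal → IsOpen U → ({p} ∪ ⋃ i, Φ i '' (B' i).truncTimeSlab (3 * M i) 0) ⊆ U → ContMDiffOn (𝓡 4) (𝓡 4) ((⊤ : ℕ∞) : WithTop ℕ∞) φ U → Topology.IsOpenEmbedding (U.restrict φ) → (∀ q ∈ U, pullbackBilin (I := 𝓡 4) (I' := 𝓡 4) φ 𝒟'.metric.val q = 𝒟.metric.val q) → (∀ q ∈ U, 𝒟'.timeOrientation.IsFutureDirected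 (mfderiv (𝓡 4) (𝓡 4) φ q (𝒟.timeOrientation.vectorField q))) → 𝒟'.toCauchyDevelopment.HasCutBondiMass (φ '' ({p} ∪ ⋃ i, Φ i '' (B' i).truncTimeSlab (3 * M i) 0)) m' → ∀ η : ℝ, 0 < η → ∃ m : ℝ, 𝒟.toCauchyDevelopment.HasCutBondiMass ({p} ∪ ⋃ i, Φ i '' (B' i).truncTimeSlab (3 * M i) 0) m ∧ m ≤ m' + γ + η) → ∃ S' : Set 𝒟.carrier, 𝒟.toCauchyDevelopment.IsNearKerrLeaf k ε N M a S' ∧ S' ⊆ 𝒟.metric.causalFuture 𝒟.timeOrientation S := by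
  intro χ m₀ N₀ k ε hχ hm₀ hε
  -- orders of the pieces
  obtain ⟨kᵣ, hR⟩ := h₃.2.2 χ m₀ N₀ k ε hχ hm₀ hε
  obtain ⟨k₂, hP⟩ := h₂ k ε hε
  obtain ⟨k₁, hC⟩ := h₁ χ m₀ k ε hχ hm₀ hε
  obtain ⟨k₃, hQ⟩ := h₃.2.1 χ m₀ hχ hm₀
  set k' : ℕ := max (max k kᵣ) (max k₁ (max k₂ k₃)) with hk'
  have hkk' : k ≤ k' := by omega
  have hkᵣ : kᵣ ≤ k' := by omega
  have hk₁ : k₁ ≤ k' := by omega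
  have hk₂ : k₂ ≤ k' := by omega
  have hk₃ : k₃ ≤ k' := by omega
  -- the residue at the working regularity `k'`
  have hR := hR k' hkᵣ
  refine ⟨k', fun Λ hΛ => ?_⟩
  by_cases hΛε : Λ ≤ ε
  · -- trivial regime: the hypothesis leaf itself (landed, p103152)
    refine ⟨1, 1, one_pos, one_pos, ?_⟩
    intro X _ _ _ _ _ _ D hD 𝒟 N M a S p mo' B' Φ hmax hN hwin hleaf hp hB hΦ hdev hsub hdis hcut
      hgap
    exact Summit.FinalStateConjecture.FinalStateConjecture.Theorems.stub_trivialRegime k k' ε Λ hkk'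
      hΛε X D 𝒟 N M a S hleaf
  · have hεΛ : ε < Λ := lt_of_not_ge hΛε
    obtain ⟨δᵣ, γᵣ, hδᵣ, hγᵣ, hR'⟩ := hR Λ hΛ hεΛ
    rcases lt_or_ge Λ 1 with hΛ1 | hΛ1
    · -- honest regime `ε < Λ < 1`
      obtain ⟨γ₂, hγ₂, hP'⟩ := hP Λ hΛ1
      obtain ⟨δ₁, γ₁, hδ₁, hγ₁, hC'⟩ := hC Λ hΛ1 hεΛ
      obtain ⟨δ₃, hδ₃, hQ'⟩ := hQ (γ₁ / 4) (by positivity)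
      set γs : ℝ := min (min (γ₁ / 2) (γ₂ / 2)) γᵣ with hγs
      have hγs0 : 0 < γs := lt_min (lt_min (by positivity) (by positivity)) hγᵣ
      have hγs₁ : γs ≤ γ₁ / 2 := (min_le_left _ _).trans (min_le_left _ _)
      have hγs₂ : γs ≤ γ₂ / 2 := (min_le_left _ _).trans (min_le_right _ _)
      have hγsᵣ : γs ≤ γᵣ := min_le_right _ _
      set δ : ℝ≥0∞ := min δ₁ (min δ₃ δᵣ) with hδ
      have hδ0 : 0 < δ := lt_min hδ₁ (lt_min hδ₃ hδᵣ)
      have hδδ₁ : δ ≤ δ₁ := min_le_left _ _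
      have hδδ₃ : δ ≤ δ₃ := (min_le_right _ _).trans (min_le_left _ _)
      have hδδᵣ : δ ≤ δᵣ := (min_le_right _ _).trans (min_le_right _ _)
      refine ⟨δ, γs, hδ0, hγs0, ?_⟩
      intro X _ _ _ _ _ _ D hD 𝒟 N M a S p mo' B' Φ hmax hN hwin hleaf hp hB hΦ hdev hsub hdis hcut
        hgap
      -- monotonicity of the collar closeness in `δ` (at the working regularity)
      have hdev_of : ∀ {dd : ℝ≥0∞}, δ ≤ dd →
          ∀ i, 𝒟.toSpacetime.truncDeviationCk (B' i) (Φ i) k' (3 * M i) 0 ≤ dd := by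
        intro dd hdd i
        exact (hdev i).trans hdd
      -- the gap clause in its definitional form, and its monotonicity in `γ`
      have hgap' : 𝒟.BondiBartnikGapLE ({p} ∪ ⋃ i, Φ i '' (B' i).truncTimeSlab (3 * M i) 0) γs :=
        hgap
      -- case split on the number of holes
      rcases N with _ | _ | n
      · -- N = 0: component (a) + gap ⇒ own cone energy ≤ γ₂; piece 2
        have hC0 : ({p} ∪ ⋃ i, Φ i '' (B' i).truncTimeSlab (3 * M i) 0) = ({p} : Set 𝒟.carrier) := by
          simp
        rw [hC0] at hgap' hcut
        have hpJ : p ∈ 𝒟.metric.causalFuture 𝒟.timeOrientation (range 𝒟.embed) :=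
          hleaf.subset_causalFuture hp
        obtain ⟨m, hm, hmle⟩ := exists_hasCutBondiMass_le_of_gap 𝒟
          (h₃.1 X D hD 𝒟 p hmax hpJ (γ₂ / 4) (by positivity)) (hgap'.mono hγs₂)
          (show (0 : ℝ) < γ₂ / 4 by positivity)
        obtain ⟨S', hS', hS'p⟩ := hP' X D hD 𝒟 M a S p m hmax (hleaf.mono hk₂ le_rfl) hp hm
          (by linarith)
        exact ⟨S', hS'.isNearKerrLeaf,
          hS'p.trans (LorentzianMetric.causalFuture_mono (singleton_subset_iff.2 hp))⟩
      · -- N = 1: piece 1 when `p` is in the collar, the hypothesis leaf is pinned sound at level `k'`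
        -- and the collar is rest-frame and oriented; residue otherwise
        by_cases hpc : ∃ i, p ∈ Φ i '' (B' i).truncTimeSlab (3 * M i) 0
        · by_cases hps : IsPinnedSoundNearKerrLeaf 𝒟.toCauchyDevelopment k' Λ 1 M a S ∧
              (∀ i, (mo' i).1 = 1) ∧ K2Route.CollarFutureOriented 𝒟 M mo' B' Φ ∧
              K2Route.CollarTimeOriented 𝒟 M a mo' B' Φ
          · -- the thick-collar block of the instance, and its weakenings to the pieces' orders
            have hcore : 𝒟.NearKerrCollarCore k' δ γs 1 M a S p mo' B' Φ :=
              ⟨hB, hΦ, hdev, hsub, hdis, hcut, hgap⟩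
            have hcore₃ := hcore.mono hk₃ hδδ₃ le_rfl
            have hcore₁ := hcore.mono hk₁ hδδ₁ le_rfl
            -- component (b): a Kerr-capped competitor of mass ≤ M + γ₁/4
            obtain ⟨m', hm', hm'le⟩ := hQ' X D hD 𝒟 M a p mo' B' Φ hmax hwin hpc hB hΦ
              hcore₃.truncDeviationCk_le
            -- gap ⇒ own collar energy ≤ M + γ₁
            have hgapC : 𝒟.BondiBartnikGapLE (collarCore M p B' Φ) γs := hgap
            obtain ⟨m, hm, hmle⟩ := exists_hasCutBondiMass_le_of_gap 𝒟 ⟨m', hm', hm'le⟩ hgapC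
              (show (0 : ℝ) < γ₁ / 4 by positivity)
            have hown : ∃ m : ℝ, 𝒟.toCauchyDevelopment.HasCutBondiMass (collarCore M p B' Φ) m ∧
                m ≤ M 0 + γ₁ :=
              ⟨m, hm, by linarith⟩
            -- piece 1: the sound leaf inside `J⁺(C)`
            obtain ⟨S', hS', hS'C⟩ := hC' X D hD 𝒟 M a S p mo' B' Φ hmax hwin (hps.1.mono hk₁ le_rfl)
              hp hpc (hps.2.1 0) hB hΦ hcore₁.truncDeviationCk_le hsub hps.2.2.1 hps.2.2.2 hown
            -- sound ⇒ typed; `J⁺(C) ⊆ J⁺(S)` since `C ⊆ S`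
            exact ⟨S', hS'.isNearKerrLeaf, hS'C.trans (LorentzianMetric.causalFuture_mono
              (Literature.Geometry.Lorentzian.collarCore_subset M p B' Φ hp hsub))⟩
          · exact hR' X D hD 𝒟 _ M a S p mo' B' Φ (Or.inr (Or.inr (Or.inr ⟨rfl, hps⟩))) hmax hN hwin
              hleaf hp hB hΦ (hdev_of hδδᵣ) hsub hdis hcut (hgap'.mono hγsᵣ)
        · push Not at hpc
          exact hR' X D hD 𝒟 _ M a S p mo' B' Φ (Or.inr (Or.inr (Or.inl ⟨rfl, hpc⟩))) hmax hN hwin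
            hleaf hp hB hΦ (hdev_of hδδᵣ) hsub hdis hcut (hgap'.mono hγsᵣ)
      · -- N ≥ 2: residue (seamed / stacked cores)
        exact hR' X D hD 𝒟 (n + 2) M a S p mo' B' Φ (Or.inr (Or.inl (by omega))) hmax hN hwin
          hleaf hp hB hΦ (hdev_of hδδᵣ) hsub hdis hcut (hgap'.mono hγsᵣ)
    · -- junk-chart regime `1 ≤ Λ`: filed-text residue
      refine ⟨δᵣ, γᵣ, hδᵣ, hγᵣ, ?_⟩
      intro X _ _ _ _ _ _ D hD 𝒟 N M a S p mo' B' Φ hmax hN hwin hleaf hp hB hΦ hdev hsub hdis hcut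
        hgap
      exact hR' X D hD 𝒟 N M a S p mo' B' Φ (Or.inl hΛ1) hmax hN hwin hleaf hp hB hΦ hdev hsub hdis
        hcut hgap

end Summit.FinalStateConjecture.FinalStateConjecture.Theorems.BondiBartnikRigidity.Split

end
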